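import Literature.Probability.Entropy.GibbsTiltTransport
import Literature.Probability.Divergences.FDivVariational
import HarnessLib

/-!
# The Donsker–Varadhan inequality and the transportation lemma for integrable (unbounded) test functions

Topic `Literature/Probability/Entropy`; companion of `GibbsTiltTransport.lean`, which treats BOUNDED test functions.  Here the
test function is only integrable with an integrable exponential — the generality of the book (needed when the reference law
is Gaussian and the observable a polynomial):

* `integral_le_toReal_klDiv_add_log_of_integrable` — `∫ g dν ≤ KL(ν ‖ μ) + log ∫ e^g dμ` for `ν`-integrable `g` with
  `μ`-integrable `e^g` (from the tree's `integral_le_toReal_klDiv_add_integral` at `g − log ∫ e^g dμ`)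
  [cite: BoucheronLugosiMassart2013, Cor. 4.14];
* `integral_sub_integral_le_of_logmgf_le'`, `integral_sub_integral_le_sqrt_of_subGaussian'` — the transportation lemma
  [cite: BoucheronLugosiMassart2013, Lemma 4.18] in that generality: a log-moment-generating-function bound
  `log E_μ e^{λ(Z − E_μ Z)} ≤ φ(λ)` gives `E_ν Z − E_μ Z ≤ (φ(λ) + KL(ν ‖ μ))/λ`, and the sub-Gaussian bound for all `λ > 0`
  gives `E_ν Z − E_μ Z ≤ √(2 v KL(ν ‖ μ))`, for every `ν` with finite relative entropy under which `Z` is integrable.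
-/

noncomputable section

namespace Literature.Probability.Entropy

open _root_.MeasureTheory Filter InformationTheory

variable {Ω : Type*} [MeasurableSpace Ω] {μ : Measure Ω} [IsProbabilityMeasure μ]

/-- **Donsker–Varadhan inequality, log form, for integrable test functions**: if `KL(ν ‖ μ) < ∞`, `g` is `ν`-integrable and
`e^g` is `μ`-integrable, then `∫ g dν ≤ KL(ν ‖ μ) + log ∫ e^g dμ`. [cite: BoucheronLugosiMassart2013, Cor. 4.14] -/
theorem integral_le_toReal_klDiv_add_log_of_integrable {ν : Measure Ω} [IsProbabilityMeasure ν] (hfin : klDiv ν μ ≠ ⊤)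
    {g : Ω → ℝ} (hg : Integrable g ν) (hexp : Integrable (fun ω => Real.exp (g ω)) μ) :
    ∫ ω, g ω ∂ν ≤ (klDiv ν μ).toReal + Real.log (∫ ω, Real.exp (g ω) ∂μ) := by
  set L : ℝ := ∫ ω, Real.exp (g ω) ∂μ with hL
  have hLpos : 0 < L := integral_exp_pos hexp
  have hg' : Integrable (fun ω => g ω - Real.log L) ν := hg.sub (integrable_const _)
  have hexp' : Integrable (fun ω => Real.exp (g ω - Real.log L)) μ := by
    simp_rw [Real.exp_sub, Real.exp_log hLpos]
    exact hexp.div_const L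
  have h := Literature.Probability.Divergences.integral_le_toReal_klDiv_add_integral hfin hg' hexp'
  have h1 : ∫ ω, (g ω - Real.log L) ∂ν = ∫ ω, g ω ∂ν - Real.log L := by
    rw [integral_sub hg (integrable_const _), integral_const, probReal_univ, one_smul]
  have h2 : ∫ ω, (Real.exp (g ω - Real.log L) - 1) ∂μ = 0 := by
    simp_rw [Real.exp_sub, Real.exp_log hLpos]
    rw [integral_sub (hexp.div_const L) (integrable_const _), integral_div, ← hL, div_self hLpos.ne',
      integral_const, probReal_univ, one_smul, sub_self]
  rw [h1, h2, add_zero] at h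
  linarith

variable {Z : Ω → ℝ}

/-- **Transportation lemma, general rate, integrable form** [cite: BoucheronLugosiMassart2013, Lemma 4.18]: if
`log E_μ e^{λ(Z − E_μ Z)} ≤ φ(λ)` at some `λ > 0` (that exponential being `μ`-integrable), then every probability measure `ν`
with `KL(ν ‖ μ) < ∞` under which `Z` is integrable has `E_ν Z − E_μ Z ≤ (φ(λ) + KL(ν ‖ μ))/λ`. -/
theorem integral_sub_integral_le_of_logmgf_le' {φl t : ℝ} (ht : 0 < t)
    (hexp : Integrable (fun ω => Real.exp (t * (Z ω - ∫ x, Z x ∂μ))) μ)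
    (hmgf : Real.log (∫ ω, Real.exp (t * (Z ω - ∫ x, Z x ∂μ)) ∂μ) ≤ φl)
    {ν : Measure Ω} [IsProbabilityMeasure ν] (hfin : klDiv ν μ ≠ ⊤) (hZν : Integrable Z ν) :
    (∫ ω, Z ω ∂ν) - (∫ ω, Z ω ∂μ) ≤ (φl + (klDiv ν μ).toReal) / t := by
  have hg : Integrable (fun ω => t * (Z ω - ∫ x, Z x ∂μ)) ν := (hZν.sub (integrable_const _)).const_mul t
  have dv := integral_le_toReal_klDiv_add_log_of_integrable (μ := μ) hfin hg hexp
  have hEψ : (∫ ω, t * (Z ω - ∫ x, Z x ∂μ) ∂ν) = t * ((∫ ω, Z ω ∂ν) - ∫ x, Z x ∂μ) := by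
    rw [integral_const_mul, integral_sub hZν (integrable_const _), integral_const, probReal_univ, one_smul]
  rw [hEψ] at dv
  rw [le_div_iff₀ ht]
  linarith

/-- The optimisation behind the sub-Gaussian transport bound: if `a ≤ K/t + v t/2` for every `t > 0` (`v > 0`, `K ≥ 0`), then
`a ≤ √(2 v K)`. [folklore] -/
private theorem le_sqrt_of_forall_le_div_add' {a v K : ℝ} (hv : 0 < v) (hK : 0 ≤ K)
    (h : ∀ t : ℝ, 0 < t → a ≤ K / t + v * t / 2) : a ≤ Real.sqrt (2 * v * K) := by
  by_cases hK0 : K = 0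
  · subst hK0
    have h' : ∀ t : ℝ, 0 < t → a ≤ v * t / 2 := fun t ht => by simpa using h t ht
    rw [mul_zero, Real.sqrt_zero]
    by_contra ha
    push Not at ha
    have := h' (a / v) (div_pos ha hv)
    have e : v * (a / v) / 2 = a / 2 := by field_simp
    linarith
  · have hKpos : 0 < K := lt_of_le_of_ne hK (Ne.symm hK0)
    set s : ℝ := Real.sqrt (2 * v * K) with hs
    have hs_pos : 0 < s := Real.sqrt_pos.2 (by positivity)
    have hs_sq : s * s = 2 * v * K := Real.mul_self_sqrt (by positivity)
    have ht : 0 < s / v := div_pos hs_pos hv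
    have key := h (s / v) ht
    have e1 : K / (s / v) + v * (s / v) / 2 = s := by
      have hsv : s / v ≠ 0 := ht.ne'
      have hs0 : s ≠ 0 := hs_pos.ne'
      field_simp
      nlinarith [hs_sq]
    linarith

/-- **Transportation lemma, sub-Gaussian case, integrable form** [cite: BoucheronLugosiMassart2013, Lemma 4.18]: if the
centred exponential moments of `Z` under `μ` exist and `log E_μ e^{λ(Z − E_μ Z)} ≤ vλ²/2` for every `λ > 0` (`v > 0`), then every
probability measure `ν` with `KL(ν ‖ μ) < ∞` under which `Z` is integrable has `E_ν Z − E_μ Z ≤ √(2 v KL(ν ‖ μ))`. -/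
theorem integral_sub_integral_le_sqrt_of_subGaussian' {v : ℝ} (hv : 0 < v)
    (hexp : ∀ t : ℝ, 0 < t → Integrable (fun ω => Real.exp (t * (Z ω - ∫ x, Z x ∂μ))) μ)
    (hmgf : ∀ t : ℝ, 0 < t → Real.log (∫ ω, Real.exp (t * (Z ω - ∫ x, Z x ∂μ)) ∂μ) ≤ v * t ^ 2 / 2)
    {ν : Measure Ω} [IsProbabilityMeasure ν] (hfin : klDiv ν μ ≠ ⊤) (hZν : Integrable Z ν) :
    (∫ ω, Z ω ∂ν) - (∫ ω, Z ω ∂μ) ≤ Real.sqrt (2 * v * (klDiv ν μ).toReal) := by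
  refine le_sqrt_of_forall_le_div_add' hv ENNReal.toReal_nonneg fun t ht => ?_
  have h := integral_sub_integral_le_of_logmgf_le' ht (hexp t ht) (hmgf t ht) hfin hZν
  have e : (v * t ^ 2 / 2 + (klDiv ν μ).toReal) / t = (klDiv ν μ).toReal / t + v * t / 2 := by
    field_simp; ring
  linarith [e.le, e.ge]

end Literature.Probability.Entropy

end
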